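import Literature.Geometry.Lorentzian.CurvatureNaturality
import Literature.Geometry.Lorentzian.IsometryProofs
import Literature.Geometry.Lorentzian.Hypersurface
import Literature.Geometry.Lorentzian.InitialData
import Literature.Geometry.Lorentzian.LeviCivitaCovDerivProofs
import HarnessLib

/-!
# Pullback of initial data sets along local diffeomorphisms; naturality of the constraints

(trunk G08 = T-LORENTZ; family `gr`; namespaces `Literature.Geometry.Lorentzian.PseudoRiemannianMetric`,
`Literature.Geometry.Lorentzian.InitialDataSet`.)

The Einstein constraint equations are geometric: if `Φ : N → M` is a local diffeomorphism (a
smooth map between manifolds of the same dimension all of whose differentials are injective)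
and `D = (h, k)` is an initial data set on `M`, then the pulled-back data
`Φ^* D = (Φ^* h, Φ^* k)` have Hamiltonian constraint function `(Φ^* D)` = that of `D` composed
with `Φ`, and momentum constraint covector `(dΦ)ᵀ` of that of `D` at `Φ u` (Bartnik–Isenberg
2004, §2: the constraint map is equivariant under diffeomorphisms; O'Neill 1983, Ch. 3,
Prop. 3.59 ff.: local isometries preserve the Levi-Civita connection and the curvature). This
file proves it:

* `PseudoRiemannianMetric.contMDiff_pullbackBilin_section` — the pullback of ANY `C^n` section
  of the bundle of bilinear forms along a `C^{n+1}` map is `C^n` (the proof of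
  `contMDiff_pullbackBilin_holds`, `IsometryProofs.lean`, verbatim for sections);
* `InitialDataSet.comap` — **the pulled-back initial data set** `Φ^* D` along an equidimensional
  immersion (`h` via `inducedRiemannianMetric`, `k` via `pullbackBilin`);
  `comap_metric` : its metric is `D.metric.comap …` (`Isometry.lean`);
* pointwise linear algebra under the isomorphism `e = dΦ_u`: `sharp_comap_apply`
  (`♯' (α ∘ e) = e⁻¹ ♯α`), `trace_comap` and `normSq_comap` (conjugate endomorphisms have equal
  traces), hence `traceK_comap`, `normSqK_comap`;
* `covDeriv₂_comap` — **naturality of the covariant differential of `k`**: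
  `(∇^{Φ^*h} Φ^*k)_u(X₀, Y₀, Z₀) = (∇^h k)_{Φ u}(dΦ X₀, dΦ Y₀, dΦ Z₀)` (from `covDeriv₂_apply`,
  `leviCivita_comap_mpullback_apply` and the chain rule), hence `divergence_comap`;
* `hamiltonianConstraintFn_comap`, `momentumConstraintFn_comap_apply` (the latter under the
  hypothesis that `tr_h k` is differentiable at `Φ u`, which holds for data on chart domains,
  `KerrData…`/`ConstraintFamilies`), and `isVacuumConstraintSolution_comap`.

Everything is proved; the only definition is the pulled-back data set; no named facts.

## References

* R. Bartnik, J. Isenberg, *The constraint equations*, in: The Einstein equations and the large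
  scale behavior of gravitational fields (2004), §2 (key `BartnikIsenberg2004`).
* B. O'Neill, *Semi-Riemannian geometry* (1983), Ch. 3, pp. 58, 90–91, Prop. 3.59–Cor. 3.61
  (key `ONeill1983`).
* Y. Choquet-Bruhat, *General Relativity and the Einstein Equations* (2009), Ch. VI, §3.
-/

noncomputable section

open Bundle Set Function Filter Manifold VectorField FiberBundle
open scoped Manifold ContDiff Topology

namespace Literature.Geometry.Lorentzian

variable {E : Type*} [NormedAddCommGroup E] [NormedSpace ℝ E] {H : Type*} [TopologicalSpace H]
  {I : ModelWithCorners ℝ E H} {M : Type*} [TopologicalSpace M] [ChartedSpace H M]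
  {E' : Type*} [NormedAddCommGroup E'] [NormedSpace ℝ E'] {H' : Type*} [TopologicalSpace H']
  {I' : ModelWithCorners ℝ E' H'} {N : Type*} [TopologicalSpace N] [ChartedSpace H' N]

/-! ### The pullback of a smooth section of the bilinear-form bundle is smooth -/

namespace PseudoRiemannianMetric

/-- **The pullback `f^* s` of a `C^n` section `s` of the bundle of bilinear forms on `TM` along a
`C^{n+1}` map `f : N → M` is a `C^n` section** of the bundle of bilinear forms on `TN` — the proof
of `contMDiff_pullbackBilin_holds` (`IsometryProofs.lean`), which uses only the smoothness of the
section: in tangent coordinates `f^* s = (Φ)ᵀ (β ∘ f) Φ` with `Φ = Df` and `β = s` read in charts.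
O'Neill 1983, Ch. 3, Def. 3.9 and Lemma 3.35 ff. [cite: ONeill1983, Ch. 3, Def. 3.9 and Lemma 3.35] -/
theorem contMDiff_pullbackBilin_section [IsManifold I' ∞ N] [IsManifold I ∞ M] {n : ℕ∞ω}
    {f : N → M} (hf : ContMDiff I' I (n + 1) f)
    {s : Π x : M, TangentSpace I x →L[ℝ] TangentSpace I x →L[ℝ] ℝ}
    (hs : ContMDiff I (I.prod 𝓘(ℝ, E →L[ℝ] E →L[ℝ] ℝ)) n
      (fun x ↦ TotalSpace.mk' (E →L[ℝ] E →L[ℝ] ℝ)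
        (E := fun x : M ↦ TangentSpace I x →L[ℝ] TangentSpace I x →L[ℝ] ℝ) x (s x))) :
    ContMDiff I' (I'.prod 𝓘(ℝ, E' →L[ℝ] E' →L[ℝ] ℝ)) n
      (fun y : N ↦ TotalSpace.mk' (E' →L[ℝ] E' →L[ℝ] ℝ)
        (E := fun y : N ↦ TangentSpace I' y →L[ℝ] TangentSpace I' y →L[ℝ] ℝ) y
        (pullbackBilin (I := I) (I' := I') f s y)) := by
  intro y₀
  rw [contMDiffAt_bilin_iff]
  refine ⟨contMDiffAt_id, ?_⟩
  set τN := trivializationAt E' (TangentSpace I' : N → Type _) y₀ with hτN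
  set τM := trivializationAt E (TangentSpace I : M → Type _) (f y₀) with hτM
  set Φ : N → E' →L[ℝ] E := inTangentCoordinates I' I id f (fun y ↦ mfderiv I' I f y) y₀ with hΦ
  have hΦs : ContMDiffAt I' 𝓘(ℝ, E' →L[ℝ] E) n Φ y₀ :=
    ContMDiffAt.mfderiv_const (hf y₀) le_rfl
  set β : M → E →L[ℝ] E →L[ℝ] ℝ := fun x ↦
    (ContinuousLinearMap.precomp ℝ (τM.symmL ℝ x)).comp ((s x).comp (τM.symmL ℝ x)) with hβ
  have hβs : ContMDiffAt I 𝓘(ℝ, E →L[ℝ] E →L[ℝ] ℝ) n β (f y₀) :=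
    ((contMDiffAt_bilin_iff (IX := I) (IB := I) (V := (TangentSpace I : M → Type _)) (b := id)
      (s := s) (x₀ := f y₀)).1 (hs (f y₀))).2
  have hf' : ContMDiffAt I' I n f y₀ := (hf y₀).of_le le_self_add
  have hβf : ContMDiffAt I' 𝓘(ℝ, E →L[ℝ] E →L[ℝ] ℝ) n (fun y ↦ β (f y)) y₀ :=
    ContMDiffAt.comp y₀ hβs hf'
  have h1 : ContMDiffAt I' 𝓘(ℝ, E' →L[ℝ] E →L[ℝ] ℝ) n (fun y ↦ (β (f y)).comp (Φ y)) y₀ :=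
    ContMDiffAt.clm_comp hβf hΦs
  have h2 : ContMDiffAt I' 𝓘(ℝ, (E →L[ℝ] ℝ) →L[ℝ] (E' →L[ℝ] ℝ)) n
      (fun y ↦ (Φ y).precomp ℝ) y₀ :=
    hΦs.clm_precomp (F₃ := ℝ)
  have hcomp : ContMDiffAt I' 𝓘(ℝ, E' →L[ℝ] E' →L[ℝ] ℝ) n
      (fun y ↦ ((Φ y).precomp ℝ).comp ((β (f y)).comp (Φ y))) y₀ :=
    ContMDiffAt.clm_comp h2 h1
  refine hcomp.congr_of_eventuallyEq ?_
  have hev : ∀ᶠ y in 𝓝 y₀, f y ∈ τM.baseSet :=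
    (hf y₀).continuousAt.preimage_mem_nhds
      (τM.open_baseSet.mem_nhds (FiberBundle.mem_baseSet_trivializationAt' (f y₀)))
  filter_upwards [hev] with y hfy
  ext e e'
  have key : ∀ v : E', τM.symmL ℝ (f y) (Φ y v) = mfderiv I' I f y (τN.symmL ℝ y v) := by
    intro v
    simp only [hΦ, inTangentCoordinates, ContinuousLinearMap.inCoordinates,
      ContinuousLinearMap.coe_comp, comp_apply, id_eq]
    exact τM.symmL_continuousLinearMapAt hfy _
  simp only [ContinuousLinearMap.coe_comp, comp_apply, ContinuousLinearMap.precomp_apply,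
    pullbackBilin_apply, hβ, key]
  rfl

end PseudoRiemannianMetric

/-! ### The pulled-back initial data set -/

namespace InitialDataSet

variable [IsManifold I ∞ M] [IsManifold I' ∞ N] [FiniteDimensional ℝ E] [FiniteDimensional ℝ E']

omit [IsManifold I' ∞ N] [FiniteDimensional ℝ E] [FiniteDimensional ℝ E'] in
/-- For Riemannian data, an immersion is a spacelike immersion for the metric `h`. [folklore] -/
theorem isSpacelikeImmersion_metric (D : InitialDataSet I M) {Φ : N → M}
    (hΦ : ContMDiff I' I (∞ + 1) Φ) (hΦ' : ∀ u, Function.Injective (mfderiv I' I Φ u)) :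
    D.metric.IsSpacelikeImmersion I' Φ := by
  refine ⟨hΦ, fun u v hv ↦ ?_⟩
  rw [PseudoRiemannianMetric.inducedBilin_apply, val_metric]
  exact D.h.pos (Φ u) _ fun h0 ↦ hv ((injective_iff_map_eq_zero _).1 (hΦ' u) v h0)

/-- **The pulled-back initial data set `Φ^* D = (Φ^* h, Φ^* k)`** along a smooth equidimensional
immersion `Φ : N → M` (a local diffeomorphism): `(Φ^* h)_u(v, w) = h_{Φ u}(dΦ v, dΦ w)`
(`inducedRiemannianMetric`, smoothness by `contMDiff_pullbackBilin_holds`) and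
`(Φ^* k)_u(v, w) = k_{Φ u}(dΦ v, dΦ w)` (`pullbackBilin`, smoothness by
`contMDiff_pullbackBilin_section`). Bartnik–Isenberg 2004, §2 (diffeomorphism equivariance of
the data); O'Neill 1983, Ch. 3, pp. 90–91. [cite: BartnikIsenberg2004, §2] -/
def comap (D : InitialDataSet I M) (Φ : N → M) (hΦ : ContMDiff I' I (∞ + 1) Φ)
    (hΦ' : ∀ u, Function.Injective (mfderiv I' I Φ u)) : InitialDataSet I' N where
  h := D.metric.inducedRiemannianMetric Φ PseudoRiemannianMetric.contMDiff_pullbackBilin_holds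
    (D.isSpacelikeImmersion_metric hΦ hΦ')
  k := pullbackBilin (I := I) (I' := I') Φ D.k
  k_symm u v w := pullbackBilin_symm Φ D.k D.k_symm u v w
  contMDiff_k := PseudoRiemannianMetric.contMDiff_pullbackBilin_section hΦ D.contMDiff_k

variable (D : InitialDataSet I M) {Φ : N → M} (hΦ : ContMDiff I' I (∞ + 1) Φ)
  (hΦ' : ∀ u, Function.Injective (mfderiv I' I Φ u))

omit [FiniteDimensional ℝ E] in
/-- The metric of `Φ^* D` at `u`: `h_{Φ u}(dΦ v, dΦ w)`. [cite: BartnikIsenberg2004, §2] -/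
@[simp]
theorem comap_h_inner (u : N) (v w : TangentSpace I' u) :
    (D.comap Φ hΦ hΦ').h.inner u v w = D.h.inner (Φ u) (mfderiv I' I Φ u v) (mfderiv I' I Φ u w) :=
  rfl

omit [FiniteDimensional ℝ E] in
/-- The tensor `k` of `Φ^* D` at `u`: `k_{Φ u}(dΦ v, dΦ w)`. [cite: BartnikIsenberg2004, §2] -/
@[simp]
theorem comap_k (u : N) (v w : TangentSpace I' u) :
    (D.comap Φ hΦ hΦ').k u v w = D.k (Φ u) (mfderiv I' I Φ u v) (mfderiv I' I Φ u w) :=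
  rfl

omit [FiniteDimensional ℝ E] [FiniteDimensional ℝ E'] in
/-- **Extensionality for initial data sets**: two data sets with the same scalar products and the
same tensors `k` are equal (the remaining fields are proofs). [folklore] -/
theorem ext' {D₁ D₂ : InitialDataSet I' N} (hh : ∀ u v w, D₁.h.inner u v w = D₂.h.inner u v w)
    (hk : ∀ u v w, D₁.k u v w = D₂.k u v w) : D₁ = D₂ := by
  obtain ⟨h₁, k₁, hs₁, hc₁⟩ := D₁
  obtain ⟨h₂, k₂, hs₂, hc₂⟩ := D₂
  obtain ⟨i₁, s₁, p₁, b₁, c₁⟩ := h₁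
  obtain ⟨i₂, s₂, p₂, b₂, c₂⟩ := h₂
  have hi : i₁ = i₂ := funext fun u ↦ ContinuousLinearMap.ext fun v ↦
    ContinuousLinearMap.ext fun w ↦ hh u v w
  have hkk : k₁ = k₂ := funext fun u ↦ ContinuousLinearMap.ext fun v ↦
    ContinuousLinearMap.ext fun w ↦ hk u v w
  subst hi hkk
  rfl

/-- **Pulling back along the identity changes nothing**: if `Φ = id` (as a function) then
`Φ^* D = D` (`d(id) = id`). O'Neill 1983, Ch. 3, p. 58. [cite: ONeill1983, Ch. 3, p. 58] -/
theorem comap_eq_self_of_eq_id (D' : InitialDataSet I' N) {Ψ : N → N}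
    (hΨ : ContMDiff I' I' (∞ + 1) Ψ) (hΨ' : ∀ u, Function.Injective (mfderiv I' I' Ψ u))
    (hid : Ψ = id) : D'.comap Ψ hΨ hΨ' = D' := by
  subst hid
  refine ext' (fun u v w ↦ ?_) (fun u v w ↦ ?_)
  · rw [comap_h_inner, mfderiv_id]
    rfl
  · rw [comap_k, mfderiv_id]
    rfl

/-- **The metric of the pulled-back data is the pullback metric** `D.metric.comap …` of
`Isometry.lean` (definitionally: both have the pullback as scalar product). [folklore] -/
theorem comap_metric (hdim : Module.finrank ℝ E' = Module.finrank ℝ E) :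
    (D.comap Φ hΦ hΦ').metric =
      D.metric.comap PseudoRiemannianMetric.contMDiff_pullbackBilin_holds Φ hΦ hΦ' hdim :=
  rfl

end InitialDataSet

/-! ### Pointwise linear algebra under the isomorphism `dΦ_u` -/

namespace PseudoRiemannianMetric

variable [IsManifold I ∞ M] [IsManifold I' ∞ N]
  [FiniteDimensional ℝ E] [FiniteDimensional ℝ E'] [CompleteSpace E] [CompleteSpace E']
  (g : PseudoRiemannianMetric I ∞ E (TangentSpace I : M → Type _))
  {Φ : N → M} (hpb : contMDiff_pullbackBilin I M I' N ∞) (hΦ : ContMDiff I' I (∞ + 1) Φ)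
  (hΦ' : ∀ u, Function.Injective (mfderiv I' I Φ u))
  (hdim : Module.finrank ℝ E' = Module.finrank ℝ E)

omit [CompleteSpace E] [CompleteSpace E'] in
/-- **Index raising is natural**: for a covector `α` at `Φ u`,
`♯^{Φ^*g}(α ∘ dΦ_u) = (dΦ_u)⁻¹ ♯^g α` (check the defining identity of `♯`). O'Neill 1983, Ch. 3,
p. 60 with Prop. 3.59. [cite: ONeill1983, Ch. 3, Prop. 3.59] -/
theorem sharp_comap_apply (u : N) (α : Module.Dual ℝ (TangentSpace I (Φ u))) :
    (g.comap hpb Φ hΦ hΦ' hdim).sharp u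
        (α ∘ₗ (mfderivEquivOfInjective (I := I) (I' := I') Φ u (hΦ' u) hdim).toLinearMap) =
      (mfderivEquivOfInjective (I := I) (I' := I') Φ u (hΦ' u) hdim).symm (g.sharp (Φ u) α) := by
  refine sharp_eq_of_forall _ u _ _ fun w ↦ ?_
  rw [val_comap, pullbackBilin_apply, mfderiv_mfderivEquivOfInjective_symm, val_sharp_apply]
  rfl

omit [CompleteSpace E] [CompleteSpace E'] in
/-- **`♯' ∘ T' ` is conjugate to `♯ ∘ T`**: for a bilinear form `T` at `Φ u` and its pullback
`T' = T ∘ (dΦ_u × dΦ_u)`, `♯^{Φ^*g} ∘ T' = (dΦ_u)⁻¹ ∘ (♯^g ∘ T) ∘ dΦ_u`. [cite: ONeill1983, Ch. 3, Prop. 3.59] -/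
theorem sharp_comp_comap (u : N) (T : LinearMap.BilinForm ℝ (TangentSpace I (Φ u))) :
    ((g.comap hpb Φ hΦ hΦ' hdim).sharp u).toLinearMap ∘ₗ
        (T.comp (mfderivEquivOfInjective (I := I) (I' := I') Φ u (hΦ' u) hdim).toLinearMap
          (mfderivEquivOfInjective (I := I) (I' := I') Φ u (hΦ' u) hdim).toLinearMap) =
      (mfderivEquivOfInjective (I := I) (I' := I') Φ u (hΦ' u) hdim).symm.conj
        ((g.sharp (Φ u)).toLinearMap ∘ₗ T) := by
  set e := mfderivEquivOfInjective (I := I) (I' := I') Φ u (hΦ' u) hdim with he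
  ext v
  rw [LinearMap.comp_apply, LinearEquiv.coe_coe, LinearEquiv.conj_apply, LinearMap.comp_apply,
    LinearMap.comp_apply, LinearEquiv.coe_coe, LinearEquiv.coe_coe, LinearEquiv.symm_symm,
    LinearMap.comp_apply, LinearEquiv.coe_coe]
  have hT : T.comp e.toLinearMap e.toLinearMap v = (T (e v)) ∘ₗ e.toLinearMap := by
    ext w; rfl
  rw [hT, sharp_comap_apply]

omit [CompleteSpace E] [CompleteSpace E'] in
/-- **The metric trace is natural**: `tr_{Φ^*g}(T ∘ (dΦ × dΦ)) = tr_g T`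
(conjugate endomorphisms have equal traces). O'Neill 1983, Ch. 3, pp. 60–61 with Prop. 3.59.
[cite: ONeill1983, Ch. 3, Prop. 3.59] -/
theorem trace_comap (u : N) (T : LinearMap.BilinForm ℝ (TangentSpace I (Φ u))) :
    (g.comap hpb Φ hΦ hΦ' hdim).trace u
        (T.comp (mfderivEquivOfInjective (I := I) (I' := I') Φ u (hΦ' u) hdim).toLinearMap
          (mfderivEquivOfInjective (I := I) (I' := I') Φ u (hΦ' u) hdim).toLinearMap) =
      g.trace (Φ u) T := by
  rw [trace, trace, sharp_comp_comap, LinearMap.trace_conj']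

omit [CompleteSpace E] [CompleteSpace E'] in
/-- **The metric square norm is natural**: `|T ∘ (dΦ × dΦ)|²_{Φ^*g} = |T|²_g`.
O'Neill 1983, Ch. 3, pp. 60–61 with Prop. 3.59. [cite: ONeill1983, Ch. 3, Prop. 3.59] -/
theorem normSq_comap (u : N) (T : LinearMap.BilinForm ℝ (TangentSpace I (Φ u))) :
    (g.comap hpb Φ hΦ hΦ' hdim).normSq u
        (T.comp (mfderivEquivOfInjective (I := I) (I' := I') Φ u (hΦ' u) hdim).toLinearMap
          (mfderivEquivOfInjective (I := I) (I' := I') Φ u (hΦ' u) hdim).toLinearMap) =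
      g.normSq (Φ u) T := by
  set e := mfderivEquivOfInjective (I := I) (I' := I') Φ u (hΦ' u) hdim with he
  have hflip : (T.comp e.toLinearMap e.toLinearMap).flip = T.flip.comp e.toLinearMap e.toLinearMap := by
    ext v w; rfl
  rw [normSq, normSq, hflip, sharp_comp_comap, sharp_comp_comap, ← LinearEquiv.conj_comp,
    LinearMap.trace_conj']

end PseudoRiemannianMetric

/-! ### Naturality of the constraint functions -/

namespace InitialDataSet

variable [IsManifold I ∞ M] [IsManifold I' ∞ N]
  [FiniteDimensional ℝ E] [FiniteDimensional ℝ E'] [CompleteSpace E] [CompleteSpace E']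
  (D : InitialDataSet I M) {Φ : N → M} (hΦ : ContMDiff I' I (∞ + 1) Φ)
  (hΦ' : ∀ u, Function.Injective (mfderiv I' I Φ u))
  (hdim : Module.finrank ℝ E' = Module.finrank ℝ E)

omit [CompleteSpace E] [CompleteSpace E'] in
/-- The pulled-back `k` as an algebraic bilinear form is `k ∘ (dΦ × dΦ)`. [folklore] -/
theorem kBilin_comap (u : N) :
    (D.comap Φ hΦ hΦ').kBilin u =
      (D.kBilin (Φ u)).comp
        (mfderivEquivOfInjective (I := I) (I' := I') Φ u (hΦ' u) hdim).toLinearMap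
        (mfderivEquivOfInjective (I := I) (I' := I') Φ u (hΦ' u) hdim).toLinearMap := by
  ext v w; rfl

omit [CompleteSpace E] [CompleteSpace E'] in
include hdim in
/-- **The mean curvature is natural**: `tr_{Φ^*h}(Φ^*k)(u) = tr_h k (Φ u)`.
[cite: BartnikIsenberg2004, §2] -/
theorem traceK_comap (u : N) : (D.comap Φ hΦ hΦ').traceK u = D.traceK (Φ u) := by
  rw [traceK, traceK, kBilin_comap D hΦ hΦ' hdim, comap_metric D hΦ hΦ' hdim,
    PseudoRiemannianMetric.trace_comap]

omit [CompleteSpace E] [CompleteSpace E'] in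
include hdim in
/-- `tr (Φ^* k) = (tr k) ∘ Φ` as functions. [cite: BartnikIsenberg2004, §2] -/
theorem traceK_comap_eq : (D.comap Φ hΦ hΦ').traceK = D.traceK ∘ Φ :=
  funext fun u ↦ D.traceK_comap hΦ hΦ' hdim u

omit [CompleteSpace E] [CompleteSpace E'] in
include hdim in
/-- **`|k|²` is natural**: `|Φ^*k|²_{Φ^*h}(u) = |k|²_h (Φ u)`. [cite: BartnikIsenberg2004, §2] -/
theorem normSqK_comap (u : N) : (D.comap Φ hΦ hΦ').normSqK u = D.normSqK (Φ u) := by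
  rw [normSqK, normSqK, kBilin_comap D hΦ hΦ' hdim, comap_metric D hΦ hΦ' hdim,
    PseudoRiemannianMetric.normSq_comap]

include hdim in
/-- **The Hamiltonian constraint function is natural**:
`(R − |k|² + (tr k)²)_{Φ^*D}(u) = (R − |k|² + (tr k)²)_D(Φ u)` (naturality of the scalar curvature,
`scalarCurvature_comap`, of `|k|²` and of `tr k`). Bartnik–Isenberg 2004, §2; O'Neill 1983, Ch. 3,
Prop. 3.59. [cite: BartnikIsenberg2004, §2] -/
theorem hamiltonianConstraintFn_comap [D.metric.HasLeviCivita] [(D.comap Φ hΦ hΦ').metric.HasLeviCivita]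
    (u : N) : (D.comap Φ hΦ hΦ').hamiltonianConstraintFn u = D.hamiltonianConstraintFn (Φ u) := by
  haveI : (D.metric.comap PseudoRiemannianMetric.contMDiff_pullbackBilin_holds Φ hΦ hΦ' hdim).HasLeviCivita :=
    ‹(D.comap Φ hΦ hΦ').metric.HasLeviCivita›
  rw [hamiltonianConstraintFn, hamiltonianConstraintFn, traceK_comap D hΦ hΦ' hdim,
    normSqK_comap D hΦ hΦ' hdim]
  congr 2
  exact D.metric.scalarCurvature_comap PseudoRiemannianMetric.contMDiff_pullbackBilin_holds hΦ hΦ' hdim u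

include hdim in
/-- **Naturality of the covariant differential of `k`**: for the pulled-back data,
`(∇^{Φ^*h} Φ^*k)_u(X₀, Y₀, Z₀) = (∇^h k)_{Φ u}(dΦ X₀, dΦ Y₀, dΦ Z₀)`. Both sides are evaluated
(`covDeriv₂_apply`) on the pullbacks `Φ^*X̃` of the canonical extensions `X̃` of `dΦ X₀, …`;
`(Φ^*k)(Φ^*X̃, Φ^*Ỹ) = k(X̃, Ỹ) ∘ Φ` (since `dΦ (dΦ)⁻¹ = id`), whose derivative along `Z₀` is
that of `k(X̃, Ỹ)` along `dΦ Z₀` (chain rule), and `∇^{Φ^*h}_{Z₀} Φ^*X̃ = (dΦ)⁻¹ ∇^h_{dΦ Z₀} X̃`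
(`leviCivita_comap_mpullback_apply`). O'Neill 1983, Ch. 3, Prop. 3.59 with Def. 3.16–3.17.
[cite: ONeill1983, Ch. 3, Prop. 3.59] -/
theorem covDeriv₂_comap [D.metric.HasLeviCivita] [(D.comap Φ hΦ hΦ').metric.HasLeviCivita]
    (u : N) (X₀ Y₀ Z₀ : TangentSpace I' u) :
    (D.comap Φ hΦ hΦ').metric.covDeriv₂ (D.comap Φ hΦ hΦ').k u X₀ Y₀ Z₀ =
      D.metric.covDeriv₂ D.k (Φ u) (mfderiv I' I Φ u X₀) (mfderiv I' I Φ u Y₀)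
        (mfderiv I' I Φ u Z₀) := by
  haveI : (D.metric.comap PseudoRiemannianMetric.contMDiff_pullbackBilin_holds Φ hΦ hΦ' hdim).HasLeviCivita :=
    ‹(D.comap Φ hΦ hΦ').metric.HasLeviCivita›
  have hΦs : ContMDiff I' I ∞ Φ := hΦ.of_le le_self_add
  have hinv : (mfderiv I' I Φ u).IsInvertible :=
    PseudoRiemannianMetric.isInvertible_mfderiv_of_injective hdim (hΦ' u)
  have h2 : (2 : ℕ∞ω) ≤ ∞ := WithTop.coe_le_coe.mpr le_top
  -- canonical extensions of `dΦ X₀, dΦ Y₀, dΦ Z₀` on `M` and their pullbacks to `N`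
  set X' : Π x : M, TangentSpace I x := FiberBundle.extend E (mfderiv I' I Φ u X₀) with hX'
  set Y' : Π x : M, TangentSpace I x := FiberBundle.extend E (mfderiv I' I Φ u Y₀) with hY'
  set Z' : Π x : M, TangentSpace I x := FiberBundle.extend E (mfderiv I' I Φ u Z₀) with hZ'
  have hX'd : MDiffAt (T% X') (Φ u) := mdifferentiableAt_extend ..
  have hY'd : MDiffAt (T% Y') (Φ u) := mdifferentiableAt_extend ..
  have hZ'd : MDiffAt (T% Z') (Φ u) := mdifferentiableAt_extend ..
  have hpull : ∀ {A : Π x : M, TangentSpace I x}, MDiffAt (T% A) (Φ u) →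
      MDiffAt (T% (mpullback I' I Φ A)) u := fun hA ↦ hA.mpullback_vectorField (hΦs u) hinv h2
  have hXu : mpullback I' I Φ X' u = X₀ := by rw [hX']; exact PseudoRiemannianMetric.mpullback_extend_mfderiv_apply hΦ' hdim u X₀
  have hYu : mpullback I' I Φ Y' u = Y₀ := by rw [hY']; exact PseudoRiemannianMetric.mpullback_extend_mfderiv_apply hΦ' hdim u Y₀
  have hZu : mpullback I' I Φ Z' u = Z₀ := by rw [hZ']; exact PseudoRiemannianMetric.mpullback_extend_mfderiv_apply hΦ' hdim u Z₀
  -- differentiability of the two `k` sections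
  have hk : MDifferentiableAt I (I.prod 𝓘(ℝ, E →L[ℝ] E →L[ℝ] ℝ))
      (fun x ↦ TotalSpace.mk' (E →L[ℝ] E →L[ℝ] ℝ)
        (E := fun x : M ↦ TangentSpace I x →L[ℝ] TangentSpace I x →L[ℝ] ℝ) x (D.k x)) (Φ u) :=
    (D.contMDiff_k (Φ u)).mdifferentiableAt (by simp)
  have hk' : MDifferentiableAt I' (I'.prod 𝓘(ℝ, E' →L[ℝ] E' →L[ℝ] ℝ))
      (fun y ↦ TotalSpace.mk' (E' →L[ℝ] E' →L[ℝ] ℝ)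
        (E := fun y : N ↦ TangentSpace I' y →L[ℝ] TangentSpace I' y →L[ℝ] ℝ) y
        ((D.comap Φ hΦ hΦ').k y)) u :=
    ((D.comap Φ hΦ hΦ').contMDiff_k u).mdifferentiableAt (by simp)
  -- evaluate both sides on the (pulled-back) extensions
  have lhs := (D.comap Φ hΦ hΦ').metric.covDeriv₂_apply_holds (x := u) hk'
    (X := mpullback I' I Φ X') (Y := mpullback I' I Φ Y') (Z := mpullback I' I Φ Z')
    (hpull hX'd) (hpull hY'd) (hpull hZ'd)
  rw [hXu, hYu, hZu] at lhs
  have rhs := D.metric.covDeriv₂_apply_holds (x := Φ u) hk (X := X') (Y := Y') (Z := Z')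
    hX'd hY'd hZ'd
  rw [hX', hY', hZ', FiberBundle.extend_apply_self, FiberBundle.extend_apply_self,
    FiberBundle.extend_apply_self, ← hX', ← hY', ← hZ'] at rhs
  rw [lhs, rhs]
  -- compare the three terms of `covDeriv₂Aux`
  unfold PseudoRiemannianMetric.covDeriv₂Aux
  have hΦu : MDifferentiableAt I' I Φ u := (hΦs u).mdifferentiableAt (by simp)
  -- values of the extensions and of the pullbacks at the base points
  have hXΦ : X' (Φ u) = mfderiv I' I Φ u X₀ := by rw [hX', FiberBundle.extend_apply_self]
  have hYΦ : Y' (Φ u) = mfderiv I' I Φ u Y₀ := by rw [hY', FiberBundle.extend_apply_self]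
  have hZΦ : Z' (Φ u) = mfderiv I' I Φ u Z₀ := by rw [hZ', FiberBundle.extend_apply_self]
  -- (1) the scalar functions agree: `Φ^*k(Φ^*X', Φ^*Y') = k(X', Y') ∘ Φ`
  have hfun : (fun y ↦ (D.comap Φ hΦ hΦ').k y (mpullback I' I Φ X' y) (mpullback I' I Φ Y' y)) =
      (fun x ↦ D.k x (X' x) (Y' x)) ∘ Φ := by
    funext y
    simp only [Function.comp_apply, comap_k, PseudoRiemannianMetric.mfderiv_mpullback_apply hΦ' hdim]
  have hsc : MDifferentiableAt I 𝓘(ℝ, ℝ) (fun x ↦ D.k x (X' x) (Y' x)) (Φ u) :=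
    mdifferentiableAt_bilin_apply hk hX'd hY'd
  -- (2) the connection terms: `∇^{Φ^*h}_{Z₀} Φ^*X' = (dΦ)⁻¹ ∇_{dΦ Z₀} X'`
  have hLX : (D.comap Φ hΦ hΦ').metric.leviCivita (mpullback I' I Φ X') u Z₀ =
      (mfderiv I' I Φ u).inverse (D.metric.leviCivita X' (Φ u) (mfderiv I' I Φ u Z₀)) :=
    D.metric.leviCivita_comap_mpullback_apply PseudoRiemannianMetric.contMDiff_pullbackBilin_holds
      hΦ hΦ' hdim hX'd Z₀
  have hLY : (D.comap Φ hΦ hΦ').metric.leviCivita (mpullback I' I Φ Y') u Z₀ =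
      (mfderiv I' I Φ u).inverse (D.metric.leviCivita Y' (Φ u) (mfderiv I' I Φ u Z₀)) :=
    D.metric.leviCivita_comap_mpullback_apply PseudoRiemannianMetric.contMDiff_pullbackBilin_holds
      hΦ hΦ' hdim hY'd Z₀
  rw [hfun, PseudoRiemannianMetric.mvfderiv_comp_apply hsc hΦu, hXu, hYu, hZu, hLX, hLY, comap_k,
    comap_k, hinv.self_apply_inverse, hinv.self_apply_inverse, hXΦ, hYΦ, hZΦ]

include hdim in
/-- **The divergence of `k` is natural**: `(div_{Φ^*h} Φ^*k)_u(Y₀) = (div_h k)_{Φ u}(dΦ Y₀)`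
(metric trace of the natural covariant differential, `trace_comap`). O'Neill 1983, Ch. 3, p. 86
with Prop. 3.59. [cite: ONeill1983, Ch. 3, Prop. 3.59] -/
theorem divergence_comap_apply [D.metric.HasLeviCivita] [(D.comap Φ hΦ hΦ').metric.HasLeviCivita]
    (u : N) (Y₀ : TangentSpace I' u) :
    (D.comap Φ hΦ hΦ').metric.divergence (D.comap Φ hΦ hΦ').k u Y₀ =
      D.metric.divergence D.k (Φ u) (mfderiv I' I Φ u Y₀) := by
  haveI : (D.metric.comap PseudoRiemannianMetric.contMDiff_pullbackBilin_holds Φ hΦ hΦ' hdim).HasLeviCivita :=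
    ‹(D.comap Φ hΦ hΦ').metric.HasLeviCivita›
  set e := mfderivEquivOfInjective (I := I) (I' := I') Φ u (hΦ' u) hdim with he
  have haux : (D.comap Φ hΦ hΦ').metric.divergenceAux (D.comap Φ hΦ hΦ').k u Y₀ =
      (D.metric.divergenceAux D.k (Φ u) (mfderiv I' I Φ u Y₀)).comp e.toLinearMap e.toLinearMap := by
    refine LinearMap.ext₂ fun X₀ Z₀ ↦ ?_
    rw [PseudoRiemannianMetric.divergenceAux_apply, covDeriv₂_comap D hΦ hΦ' hdim]
    rfl
  rw [PseudoRiemannianMetric.divergence_apply, PseudoRiemannianMetric.divergence_apply, haux]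
  exact D.metric.trace_comap PseudoRiemannianMetric.contMDiff_pullbackBilin_holds hΦ hΦ' hdim u _

include hdim in
/-- **The momentum constraint covector is natural** (given that `tr_h k` is differentiable at
`Φ u`, so that the chain rule applies to `tr(Φ^*k) = (tr k) ∘ Φ`):
`(div k − d tr k)_{Φ^*D}(u)(Y₀) = (div k − d tr k)_D(Φ u)(dΦ Y₀)`. Bartnik–Isenberg 2004, §2;
O'Neill 1983, Ch. 3, Prop. 3.59. [cite: BartnikIsenberg2004, §2] -/
theorem momentumConstraintFn_comap_apply [D.metric.HasLeviCivita]
    [(D.comap Φ hΦ hΦ').metric.HasLeviCivita] (u : N)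
    (htr : MDifferentiableAt I 𝓘(ℝ, ℝ) D.traceK (Φ u)) (Y₀ : TangentSpace I' u) :
    (D.comap Φ hΦ hΦ').momentumConstraintFn u Y₀ =
      D.momentumConstraintFn (Φ u) (mfderiv I' I Φ u Y₀) := by
  have hΦu : MDifferentiableAt I' I Φ u := ((hΦ.of_le le_self_add) u).mdifferentiableAt (by simp)
  have key : mfderiv I' 𝓘(ℝ, ℝ) (D.comap Φ hΦ hΦ').traceK u Y₀ =
      mfderiv I 𝓘(ℝ, ℝ) D.traceK (Φ u) (mfderiv I' I Φ u Y₀) := by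
    rw [traceK_comap_eq D hΦ hΦ' hdim, mfderiv_comp u htr hΦu]
    rfl
  rw [momentumConstraintFn_apply, momentumConstraintFn_apply, divergence_comap_apply D hΦ hΦ' hdim]
  exact congrArg₂ (· - ·) rfl key

include hdim in
/-- **Pullbacks of solutions of the vacuum constraints are solutions** (diffeomorphism
equivariance of the constraint map), given differentiability of the mean curvature of `D`.
Bartnik–Isenberg 2004, §2; Choquet-Bruhat 2009, Ch. VI, §3. [cite: BartnikIsenberg2004, §2] -/
theorem isVacuumConstraintSolution_comap [D.metric.HasLeviCivita]
    [(D.comap Φ hΦ hΦ').metric.HasLeviCivita] (hD : D.IsVacuumConstraintSolution)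
    (htr : ∀ x, MDifferentiableAt I 𝓘(ℝ, ℝ) D.traceK x) :
    (D.comap Φ hΦ hΦ').IsVacuumConstraintSolution := by
  intro u
  refine ⟨?_, ?_⟩
  · rw [hamiltonianConstraintFn_comap D hΦ hΦ' hdim, (hD (Φ u)).1]
  · ext Y₀
    rw [momentumConstraintFn_comap_apply D hΦ hΦ' hdim u (htr (Φ u)), (hD (Φ u)).2]
    rfl

end InitialDataSet

end Literature.Geometry.Lorentzian

end
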